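import Summits.Ventures.LatticeQCDFlow.TrivializingMaps.FisherStaircase
import Summits.Ventures.LatticeQCDFlow.TrivializingMaps.FisherStaircaseLength

/-!
HONEST FRAMING: exact (Metropolis-corrected) sampling algorithms for lattice gauge theory; figures
of merit are autocorrelation/cost numbers at stated couplings and volumes; no continuum-physics
claim.

# FisherStaircaseZeroSet — THEOREM S, several-zeros form, docked to the lattice partition
function: the stage count of a perturbative staircase is at least the quasihyperbolic length of
the coupling interval in the complement of the WHOLE Fisher zero set of `Z_L`, and the greedy
staircase is optimal (THEORY-1.md §31.1 (iii), remarks (a)–(b))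

Proposed tree path: `Summits/Ventures/LatticeQCDFlow/TrivializingMaps/FisherStaircaseZeroSet.lean`
(OURS — venture-side, never `Literature/`). Composes `FisherStaircase`
(`Staircase.step_le_of_stage_summable`: an `η`-admissible stage at `x` has `Δ ≤ (1-η)|x - s₀|`
for every Fisher zero `s₀`) with the pure length file `FisherStaircaseLength`
(`Staircase.integral_inv_infDist_le_mul_log`, `Staircase.le_greedy`). Cell `lqcd-flow` (pub-lqcd),
unit `pub-lqcd-theory1-g19`, 2026-08-22.

Setting ([Luscher2010Trivializing] §2, §4; as `FisherStaircase`): smooth action `S` on `SU(n)^E`,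
`Z(s) = ∫ D[U] e^{-sS}` (entire, positive on `ℝ`), Fisher zero set `F = {s | Z(s) = 0}` (closed,
off the real axis); a `K`-stage staircase with margin `η ∈ (0,1)`: real couplings
`x₀ ≤ x₁ ≤ … ≤ x_K`, stage `k` = the Taylor series of `Z′/Z = -⟨S⟩` at `x_k`, summable at
`x_k + Δ_k/(1-η)`, `Δ_k = x_{k+1} - x_k`.

Results (all `[ours]`):
* `isClosed_actionZ_zeroSet` [folklore].
* **`Staircase.actionZ_integral_inv_infDist_le`** (THEOREM S, several zeros): if `Z` has a zero,
  every such staircase satisfies `∫_{x₀}^{x_K} dt / dist(t, F) ≤ K · log(1/η)` — the number of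
  stages is at least the Gehring–Palka quasihyperbolic length of `[x₀, x_K]` in `ℂ ∖ F` divided
  by `log(1/η)`; this dominates each single-zero bound `Staircase.actionZ_arsinh_sub_le`
  (`dist(t, F) ≤ |t - s₀|`).
* **`Staircase.actionZ_le_greedy`** (optimality): every such staircase is dominated termwise by the
  greedy chain `y_{k+1} ≥ y_k + (1-η)·dist(y_k, F)`, `y₀ ≥ x₀` — the minimal number of stages to
  reach a coupling `β` is the greedy count, computable from the zero set alone.
* Wilson action: `wilson_staircase_integral_le`, `wilson_staircase_le_greedy`.
NOT claimed: any zero location for any `L`, `β` (THEORY-1 §31.3's numbers rest on printed MCMC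
zeros = labelled input); anything about other continuation schemes; any cost statement.
-/

open MeasureTheory ProbabilityTheory Filter Topology Complex Set Metric
open Literature.MathematicalPhysics.QuantumFieldTheory
open Literature.MathematicalPhysics.QuantumFieldTheory.Luscher2010
open Literature.MathematicalPhysics.QuantumFieldTheory.WilsonFlow (coeConfig continuous_coeConfig)
open scoped Matrix Matrix.Norms.Frobenius ContDiff

namespace Summit.Ventures.LatticeQCDFlow.TrivializingMaps

/-! ## §1 General smooth action -/

section ActionZ

variable {d L n : ℕ} [NeZero L] {B : SuBasis n} {S : AmbConfig d L n → ℝ}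

/-- The Fisher zero set of `Z(s) = ∫ D[U] e^{-sS}` is closed. [folklore] -/
theorem isClosed_actionZ_zeroSet (hS : ContDiff ℝ ∞ S) :
    IsClosed {s : ℂ | complexMGF (fun U => -S (coeConfig U))
      (trivialMeasure (Matrix.specialUnitaryGroup (Fin n) ℂ) d L) s = 0} :=
  isClosed_eq (differentiable_actionZ (d := d) (L := L) (n := n) hS).continuous continuous_const

namespace Staircase

/-- **THEOREM S (several-zeros form, docked).** For a smooth action whose partition function has a
zero, every `η`-margined `K`-stage staircase `x₀ ≤ … ≤ x_K` of re-expanded flow-constant series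
satisfies `∫_{x₀}^{x_K} dt / dist(t, F) ≤ K · log(1/η)`, `F` the Fisher zero set: the stage count
is at least the quasihyperbolic length of the coupling interval in `ℂ ∖ F` over `log(1/η)`.
[ours] -/
theorem actionZ_integral_inv_infDist_le (hS : ContDiff ℝ ∞ S) {s₀ : ℂ}
    (hz : complexMGF (fun U => -S (coeConfig U))
      (trivialMeasure (Matrix.specialUnitaryGroup (Fin n) ℂ) d L) s₀ = 0)
    {η : ℝ} (hη0 : 0 < η) (hη1 : η < 1) {K : ℕ} {x : ℕ → ℝ} (hmono : ∀ k < K, x k ≤ x (k + 1))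
    (hadm : ∀ k < K, Summable fun j : ℕ => (j.factorial : ℂ)⁻¹ *
      iteratedDeriv j (fun w => deriv (complexMGF (fun U => -S (coeConfig U))
          (trivialMeasure (Matrix.specialUnitaryGroup (Fin n) ℂ) d L)) w /
        complexMGF (fun U => -S (coeConfig U))
          (trivialMeasure (Matrix.specialUnitaryGroup (Fin n) ℂ) d L) w) (x k) *
      (((x k + (x (k + 1) - x k) / (1 - η) : ℝ) : ℂ) - x k) ^ j) :
    ∫ t in x 0..x K, (infDist (t : ℂ) {s : ℂ | complexMGF (fun U => -S (coeConfig U))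
      (trivialMeasure (Matrix.specialUnitaryGroup (Fin n) ℂ) d L) s = 0})⁻¹
      ≤ K * Real.log (1 / η) :=
  integral_inv_infDist_le_mul_log (isClosed_actionZ_zeroSet (d := d) (L := L) (n := n) hS)
    ⟨s₀, hz⟩ (fun t => actionZ_ofReal_ne_zero (d := d) (L := L) (n := n) hS t) hη0 hη1.le
    fun k hk _ hs₁ => step_le_of_stage_summable hS (sub_nonneg.mpr (hmono k hk)) hη1 (hadm k hk)
      hs₁

/-- **Optimality of the greedy staircase (docked).** Every `η`-margined staircase is dominated
termwise by any chain `y` that takes at least the full admissible step w.r.t. the Fisher zero set,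
`y_k + (1-η)·dist(y_k, F) ≤ y_{k+1}`, from `x₀ ≤ y₀`: no perturbative staircase reaches a coupling
in fewer stages than the greedy one. [ours] -/
theorem actionZ_le_greedy (hS : ContDiff ℝ ∞ S) {s₀ : ℂ}
    (hz : complexMGF (fun U => -S (coeConfig U))
      (trivialMeasure (Matrix.specialUnitaryGroup (Fin n) ℂ) d L) s₀ = 0)
    {η : ℝ} (hη0 : 0 ≤ η) (hη1 : η < 1) {K : ℕ} {x y : ℕ → ℝ}
    (hmono : ∀ k < K, x k ≤ x (k + 1))
    (hadm : ∀ k < K, Summable fun j : ℕ => (j.factorial : ℂ)⁻¹ *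
      iteratedDeriv j (fun w => deriv (complexMGF (fun U => -S (coeConfig U))
          (trivialMeasure (Matrix.specialUnitaryGroup (Fin n) ℂ) d L)) w /
        complexMGF (fun U => -S (coeConfig U))
          (trivialMeasure (Matrix.specialUnitaryGroup (Fin n) ℂ) d L) w) (x k) *
      (((x k + (x (k + 1) - x k) / (1 - η) : ℝ) : ℂ) - x k) ^ j)
    (hy : ∀ k < K, y k + (1 - η) * infDist (y k : ℂ) {s : ℂ | complexMGF (fun U => -S (coeConfig U))
      (trivialMeasure (Matrix.specialUnitaryGroup (Fin n) ℂ) d L) s = 0} ≤ y (k + 1))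
    (h0 : x 0 ≤ y 0) : x K ≤ y K := by
  refine le_greedy (infDist_ofReal_le_add_abs _) hη0 hη1.le (fun k hk => ?_) hy h0
  have h : x (k + 1) - x k ≤ (1 - η) * infDist (x k : ℂ) {s : ℂ |
      complexMGF (fun U => -S (coeConfig U))
        (trivialMeasure (Matrix.specialUnitaryGroup (Fin n) ℂ) d L) s = 0} :=
    step_le_mul_infDist ⟨s₀, hz⟩ hη1.le fun _ hs₁ =>
      step_le_of_stage_summable hS (sub_nonneg.mpr (hmono k hk)) hη1 (hadm k hk) hs₁
  linarith

end Staircase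

end ActionZ

/-! ## §2 Wilson action (`S_W = ∑_p Re tr(1 - U_p)`, `s = β/N`) -/

section Wilson

variable {d L n : ℕ} [NeZero L]

/-- **COROLLARY S (Wilson action, several zeros):** for the volume-`L` Wilson partition function
`Z_L`, every `η`-margined `K`-stage staircase satisfies
`∫_{x₀}^{x_K} dt / dist(t, {Z_L = 0}) ≤ K · log(1/η)` as soon as `Z_L` has a zero.
[ours; cf. Luscher2010Trivializing §4.5(b)] -/
theorem wilson_staircase_integral_le {s₀ : ℂ}
    (hz : complexMGF (fun U => -ambWilsonAction (coeConfig U))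
      (trivialMeasure (Matrix.specialUnitaryGroup (Fin n) ℂ) d L) s₀ = 0)
    {η : ℝ} (hη0 : 0 < η) (hη1 : η < 1) {K : ℕ} {x : ℕ → ℝ} (hmono : ∀ k < K, x k ≤ x (k + 1))
    (hadm : ∀ k < K, Summable fun j : ℕ => (j.factorial : ℂ)⁻¹ *
      iteratedDeriv j (fun w => deriv (complexMGF (fun U => -ambWilsonAction (coeConfig U))
          (trivialMeasure (Matrix.specialUnitaryGroup (Fin n) ℂ) d L)) w /
        complexMGF (fun U => -ambWilsonAction (coeConfig U))
          (trivialMeasure (Matrix.specialUnitaryGroup (Fin n) ℂ) d L) w) (x k) *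
      (((x k + (x (k + 1) - x k) / (1 - η) : ℝ) : ℂ) - x k) ^ j) :
    ∫ t in x 0..x K, (infDist (t : ℂ) {s : ℂ | complexMGF (fun U => -ambWilsonAction (coeConfig U))
      (trivialMeasure (Matrix.specialUnitaryGroup (Fin n) ℂ) d L) s = 0})⁻¹
      ≤ K * Real.log (1 / η) :=
  Staircase.actionZ_integral_inv_infDist_le (d := d) (L := L) (n := n) contDiff_ambWilsonAction hz
    hη0 hη1 hmono hadm

/-- **COROLLARY S (Wilson action, greedy optimality).** [ours] -/
theorem wilson_staircase_le_greedy {s₀ : ℂ}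
    (hz : complexMGF (fun U => -ambWilsonAction (coeConfig U))
      (trivialMeasure (Matrix.specialUnitaryGroup (Fin n) ℂ) d L) s₀ = 0)
    {η : ℝ} (hη0 : 0 ≤ η) (hη1 : η < 1) {K : ℕ} {x y : ℕ → ℝ}
    (hmono : ∀ k < K, x k ≤ x (k + 1))
    (hadm : ∀ k < K, Summable fun j : ℕ => (j.factorial : ℂ)⁻¹ *
      iteratedDeriv j (fun w => deriv (complexMGF (fun U => -ambWilsonAction (coeConfig U))
          (trivialMeasure (Matrix.specialUnitaryGroup (Fin n) ℂ) d L)) w /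
        complexMGF (fun U => -ambWilsonAction (coeConfig U))
          (trivialMeasure (Matrix.specialUnitaryGroup (Fin n) ℂ) d L) w) (x k) *
      (((x k + (x (k + 1) - x k) / (1 - η) : ℝ) : ℂ) - x k) ^ j)
    (hy : ∀ k < K, y k + (1 - η) * infDist (y k : ℂ) {s : ℂ |
      complexMGF (fun U => -ambWilsonAction (coeConfig U))
        (trivialMeasure (Matrix.specialUnitaryGroup (Fin n) ℂ) d L) s = 0} ≤ y (k + 1))
    (h0 : x 0 ≤ y 0) : x K ≤ y K :=
  Staircase.actionZ_le_greedy (d := d) (L := L) (n := n) contDiff_ambWilsonAction hz hη0 hη1 hmono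
    hadm hy h0

end Wilson

end Summit.Ventures.LatticeQCDFlow.TrivializingMaps
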